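import Summits.ResolutionOfSingularities.ResolutionOfSingularities.Theorems.EquisingularLiftEquisingularLiftNatModelChainStep
import HarnessLib

/-!
# [OURS · L1 W4.5(b) · EL♮] THE MODEL STEP IN CHAIN CURRENCY — the supplier's iteration brick for K5's sub-chain protocol
# (`target_elnat_of_subchainResolution`, p522255)

Crux `EquisingularLiftNat` = stmt-ResolutionOfSingularities-20038 (child EL♮(3) = stmt-20148), route EquisingularLift, line `sections`;
helper file `--supports … --as helper` by res-D-pv-029. HONEST FRAMING: OURS; NOT a statement of any manuscript. AI-written, weaker than
expert review. No `sorry`; standard axioms.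

A supplier of K5's `HSUB(Reach)` (e.g. res-L1-w45b-stub-1's T-M1-SCHEME for lead-2's v7 (TC⁺)) runs a downstairs sub-chain step by
step; at each step it owns an admissible upstairs centre `C` (regular, `O`-flat) with prescribed special fibre `C · 𝒪_F = D` and must
return the next stage IN THE FORMAT K5 CONSUMES. `modelStep_chain` packages exactly that: K2 `modelStep` (p509016) + the bookkeeping
of the engine's own Δ-branch (integrality of the two new schemes, dominance over `O`, irreducibility of the new strict-transform set
through the model — `isIrreducible_of_model`, p511521). INPUT: the engine context (`q : P → Spec O`, `Y`, `Ch` with its closure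
property and `Ch ⇒ Split.Chain`, `θ : O ↠ k`), a stage `(X, σ, S)` with `Ch`, `X` integral regular locally Noetherian and dominant
over `O`, its model square `j : F → X` (`F` integral) with `j '' T = S`; centres `C` on `X` and `D` on `F` with
`C.comap j = D`, `C` regular and `O`-flat, `σ '' supp C` off the generic point of `Y`, `supp D ⊆ T ⊄ supp D`; blow-ups `τ` of `C`
and `υ` of `D`. OUTPUT: `Ch (X₂, τ ≫ σ, j₂ '' T₂)` with `T₂ = closure υ⁻¹(T ∖ supp D)`, `X₂` integral regular locally Noetherian
dominant, the model square `j₂` with `j₂ ≫ τ = υ ≫ j`, `T₂` irreducible, `F₂` integral.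

* `off_generic_of_subset_preimage` — the convenient sufficient condition for the off-generic clause inside a carrier: if
  `supp C ⊆ τ₀⁻¹ A` for a set `A ⊆ X₀` whose image misses the generic points of `Y`, so does `σ '' supp C` for `σ = τ₀ ≫ σ₀`.
-/

set_option linter.dupNamespace false -- mandated namespace `Summit.<Summit>.<Problem>` of this single-conjunct summit

noncomputable section

open CategoryTheory CategoryTheory.Limits AlgebraicGeometry TopologicalSpace Topology
open Literature.AlgebraicGeometry.Resolution
open AlgebraicGeometry.Scheme.IdealSheafData
open Summit.ResolutionOfSingularities.ResolutionOfSingularities.Theses.EquisingularLift.Split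
open Summit.ResolutionOfSingularities.ResolutionOfSingularities.Cruxes.EquisingularLift.StrataSplit

namespace Summit.ResolutionOfSingularities.ResolutionOfSingularities.Cruxes.EquisingularLiftNat.Sections

/-- Off-generic through a carrier: if `supp C ⊆ τ₀⁻¹ A` and `σ₀ '' A` contains no generic point of `Y`, then `(τ₀ ≫ σ₀) '' supp C`
contains none. [folklore] -/
theorem off_generic_of_subset_preimage {P X₀ X : Scheme.{0}} {Y : Set P} (σ₀ : X₀ ⟶ P) (τ₀ : X ⟶ X₀) (A : Set X₀)
    (hA : ∀ a ∈ A, ¬ IsGenericPoint (σ₀ a) Y) (S : Set X) (hS : S ⊆ τ₀ ⁻¹' A) :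
    (τ₀ ≫ σ₀) '' S ⊆ {y : P | ¬ IsGenericPoint y Y} := by
  rintro _ ⟨c, hc, rfl⟩
  rw [Scheme.Hom.comp_apply]
  exact hA _ (hS hc)

/-- **THE MODEL STEP IN CHAIN CURRENCY** (see the module docstring). [cite: StacksProject, Tag 0805 with Tag 056P; Liu2002, Thm. 8.1.19] -/
theorem modelStep_chain (O : Type) [CommRing O] [IsDomain O] [IsDiscreteValuationRing O] (k : Type) [Field k] (θ : O →+* k)
    (hθ : Function.Surjective θ)
    (P : Scheme.{0}) (q : P ⟶ Spec (.of O)) (Y : Set P) (hYirr : IsIrreducible Y) (hYcl : IsClosed Y)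
    (Ch : ∀ X' : Scheme.{0}, (X' ⟶ P) → Set X' → Prop)
    (hChain : ∀ (X' : Scheme.{0}) (σ : X' ⟶ P) (S : Set X'), Ch X' σ S → Chain P Y X' σ S)
    (hStep : ∀ (X' X'' : Scheme.{0}) (σ' : X' ⟶ P) (S' : Set X') (C : X'.IdealSheafData) (τ : X'' ⟶ X'),
      Ch X' σ' S' → IsBlowup τ C → Scheme.IsRegular C.subscheme → Flat (C.subschemeι ≫ σ' ≫ q) →
      σ' '' (C.support : Set X') ⊆ {x : P | ¬ IsGenericPoint x Y} →
      (C.support : Set X') ∩ (σ' ≫ q) ⁻¹' {IsLocalRing.closedPoint O} ⊆ S' →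
      Ch X'' (τ ≫ σ') (closure (τ ⁻¹' (S' \ (C.support : Set X')))))
    -- the stage and its model
    (X : Scheme.{0}) (σ : X ⟶ P) (S : Set X) (hCh : Ch X σ S) [IsIntegral X] [IsLocallyNoetherian X]
    (hreg : Scheme.IsRegular X) (hdom : IsDominant (σ ≫ q))
    (F : Scheme.{0}) [IsIntegral F] (j : F ⟶ X) (t : F ⟶ Spec (.of k))
    (hsq : IsPullback j t (σ ≫ q) (Spec.map (CommRingCat.ofHom θ)))
    (T : Set F) (hTS : j '' T = S)
    -- the centres
    (C : X.IdealSheafData) (D : F.IdealSheafData) (hCD : C.comap j = D)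
    (hCreg : Scheme.IsRegular C.subscheme) (hCflat : Flat (C.subschemeι ≫ σ ≫ q))
    (hoff : σ '' (C.support : Set X) ⊆ {x : P | ¬ IsGenericPoint x Y})
    (hDT : (D.support : Set F) ⊆ T) (hTD : ¬ T ⊆ (D.support : Set F))
    -- the blow-ups
    (X₂ : Scheme.{0}) (τ : X₂ ⟶ X) (hτ : IsBlowup τ C) (F₂ : Scheme.{0}) (υ : F₂ ⟶ F) (hυ : IsBlowup υ D) :
    IsIntegral X₂ ∧ IsLocallyNoetherian X₂ ∧ Scheme.IsRegular X₂ ∧ IsDominant ((τ ≫ σ) ≫ q) ∧ IsIntegral F₂ ∧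
    IsIrreducible (closure (υ ⁻¹' (T \ (D.support : Set F)))) ∧
    ∃ (j₂ : F₂ ⟶ X₂) (t₂ : F₂ ⟶ Spec (.of k)),
      IsPullback j₂ t₂ ((τ ≫ σ) ≫ q) (Spec.map (CommRingCat.ofHom θ)) ∧ j₂ ≫ τ = υ ≫ j ∧
      Ch X₂ (τ ≫ σ) (j₂ '' closure (υ ⁻¹' (T \ (D.support : Set F)))) := by
  haveI : IsClosedImmersion (Spec.map (CommRingCat.ofHom θ)) := IsClosedImmersion.spec_of_surjective _ hθ
  obtain ⟨hCh₂, hreg₂, hnoeth₂, j₂, t₂, hsq₂, hcomm, hsets⟩ :=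
    modelStep O k θ hθ P q Y Ch hStep X σ S hCh hreg F j t hsq T hTS C D hCD hCreg hCflat hoff hDT X₂ τ hτ F₂ υ hυ
  -- the centres are proper ideal sheaves
  have hDne : D ≠ ⊥ := by
    intro h
    apply hTD
    rw [h, Scheme.IdealSheafData.support_bot]
    exact Set.subset_univ _
  have hCne : C ≠ ⊥ := by
    intro h
    apply hDne
    rw [← hCD, h]
    ext U : 2
    simp [Scheme.IdealSheafData.comap]
  haveI hint₂ : IsIntegral X₂ := hτ.isIntegral hCne
  haveI : IsDominant τ := isDominant_of_isBlowup hτ hCne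
  haveI : IsDominant (σ ≫ q) := hdom
  have hdom₂ : IsDominant ((τ ≫ σ) ≫ q) := by
    have : IsDominant (τ ≫ σ ≫ q) := inferInstance
    simpa only [Category.assoc] using this
  haveI hF₂ : IsIntegral F₂ := hυ.isIntegral hDne
  haveI hnoeth₂' := hnoeth₂
  haveI : IsClosedImmersion j₂ := MorphismProperty.IsStableUnderBaseChange.of_isPullback hsq₂.flip inferInstance
  have hirr : IsIrreducible (closure (υ ⁻¹' (T \ (D.support : Set F)))) :=
    isIrreducible_of_model hYirr hYcl (hChain _ _ _ hCh₂) j₂ _ isClosed_closure hsets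
  refine ⟨hint₂, hnoeth₂, hreg₂, hdom₂, hF₂, hirr, j₂, t₂, hsq₂, hcomm, ?_⟩
  rw [hsets]; exact hCh₂

end Summit.ResolutionOfSingularities.ResolutionOfSingularities.Cruxes.EquisingularLiftNat.Sections

end
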